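import Summits.Langlands.Langlands.Theorems.IrreducibilityBySelfDualityReciprocityUpToIrreducibilityWDUnramifiedUniqueness
import Summits.Langlands.Langlands.Theorems.IrreducibilityBySelfDualityReciprocityUpToIrreducibilityTransportFrobCharpoly
import Summits.Langlands.Langlands.Theorems.IrreducibilityBySelfDualityReciprocityUpToIrreducibilityRecGLTwoUnramified
import Summits.Langlands.Langlands.Theorems.IrreducibilityBySelfDualityReciprocityUpToIrreducibilityRecGLUnramified
import Literature.NumberTheory.Automorphic.LocalComponentBJExistsProofs
import Literature.NumberTheory.Automorphic.HarishChandraFinitenessGL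
import HarnessLib

/-!
# Line `Sketch` for the crux `ReciprocityUpToIrreducibility` (item stmt-Langlands-14328), continuation c5:
# rank `n` — the unramified matching for EVERY reciprocity datum (assembly of wave N4)

Support file (closes nothing; continuation lead c5, prover-line-stmt-Langlands-14328-c5-0).

c3/c4 reduced both local–global stubs of the line (`stub_pairCompatibilityAway`, `…Above`), on the
unramified-at-`v` sector, to the ℓ-blind matching `rec_v(π_v) = [ι(ρ|_{W_{K_v}}, 0)^{F-ss}]`
(`localGlobalCompatibleAt_away_iff_of_isUnramifiedAt`, `localGlobalCompatibleAt_above_iff_of_isUnramifiedAt`)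
and settled it in rank one.  This file assembles the four registered stubs of wave N4 (all landed:
H1 `stub_wdUnramified_isEquivalent_of_charpoly_eq` p127316, H2 `stub_transport_frobCharpoly` p127278,
H3 `stub_recGL_two_unramified` p127348, H4 `stub_recGL_unramified_of_unramifiedComputation` p127491)
into the rank-`n` matching at the places where `π` and `ρ` are unramified and Satake–Frobenius
compatible:

* `exists_frobSemisimplification_unramified` — the Frobenius-semisimplification of an unramified
  `N = 0` Weil–Deligne representation on `ℂⁿ` keeps `N = 0`, the trivial inertia action and every
  characteristic polynomial (a commuting nilpotent perturbation does not change it);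
* `hasFrobSemisimpleClass_of_unramified_charpoly` — the formal matching: if `rℂ` is unramified with
  `N = 0` and geometric-Frobenius characteristic polynomial `P`, and every Frobenius-semisimple
  representative of the class `c` is unramified with `N = 0` and the same `P`, then
  `rℂ.HasFrobSemisimpleClass c` (uniqueness stub H1 applied to `rℂ^{F-ss}`);
* `rankTwo_localGlobalCompatibleAt_of_satakeFrobCompatibleAt` — **`GL₂`, every `Rec`,
  unconditionally in the local theory**: for a cuspidal `π` on `GL₂(𝔸_K)` and `ρ : Γ_K → GL₂(ℚ̄_ℓ)`
  Satake–Frobenius compatible with `π` at `v`, `LocalGlobalCompatibleAt Rec ι π ρ v` (under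
  `FontaineDatumExists`, used at `v ∣ ℓ` only); hence `Corresponds Rec ι π ρ` reduces to the finitely
  many non-Satake places (`rankTwo_corresponds_of_badPlaces`);
* `localGlobalCompatibleAt_of_satakeFrobCompatibleAt_of_unramifiedComputation` — the same for `GL_n`,
  `2 ≤ n`, modulo the Jacquet–Shalika unramified computation (named fact
  `hasRSLFactor_of_isSatakeParameter_haar` at `(n, 1)`).

No definitions; std axioms.

References: J. Tate, *Number theoretic background*, Corvallis 1979, (4.1.3)–(4.2.1)
[TateCorvallis1979]; P. Deligne, *Les constantes des équations fonctionnelles*, Antwerp II (1973),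
§8.4–8.6 [DeligneAntwerpII1973]; M. Harris, R. Taylor, Ann. of Math. Studies 151 (2001), Thm. A
[HarrisTaylorAMS2001]; K. Buzzard, T. Gee, LMS Lecture Notes 414 (2014), Conj. 3.2.1–3.2.2
[BuzzardGeeLMS2014]; H. Jacquet, J. Shalika, Amer. J. Math. 103 (1981), §2 [JacquetShalika1981].
-/

noncomputable section

set_option linter.dupNamespace false -- project-wide option (lakefile weak.linter.dupNamespace); `Summit.Langlands.Langlands` is the mandated namespace

open scoped MatrixGroups Matrix NumberField Classical Polynomial
open Filter IsDedekindDomain Field Polynomial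
open Literature.NumberTheory.Automorphic Literature.NumberTheory.GaloisRepresentations
open Literature.NumberTheory.PAdicHodge
open Summit.Langlands

namespace Summit.Langlands.Langlands.Theorems.ReciprocityUpToIrreducibility

/-! ### The formal matching on `ℂⁿ` -/

section WD

variable {F : Type} [Field F] [ValuativeRel F] [TopologicalSpace F] [IsNonarchimedeanLocalField F]
  {n : ℕ}

/-- **The Frobenius-semisimplification of an unramified `N = 0` Weil–Deligne representation** on
`ℂⁿ` (it exists: `WeilDeligneRep.exists_isFrobSemisimplificationOf`, Deligne 8.5) has `N = 0`, is
trivial on inertia, and has the same characteristic polynomial at every `w ∈ W_F` — `ρ(w)` and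
`ρ^{ss}(w)` differ by a commuting nilpotent (`LinearMap.charpoly_add_eq_of_isNilpotent_of_commute`).
[cite: DeligneAntwerpII1973, §8.5–8.6] [cite: TateCorvallis1979, (4.1.3)] -/
theorem exists_frobSemisimplification_unramified (r : WeilDeligneRep F ℂ (Fin n → ℂ)) (hN : r.N = 0)
    (hρ : WeilGroup.IsUnramifiedRep r.ρ) :
    ∃ r' : WeilDeligneRep F ℂ (Fin n → ℂ), r'.IsFrobSemisimplificationOf r ∧ r'.N = 0 ∧
      WeilGroup.IsUnramifiedRep r'.ρ ∧ ∀ w : WeilGroup F, (r'.ρ w).charpoly = (r.ρ w).charpoly := by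
  obtain ⟨r', hr'⟩ := WeilDeligneRep.exists_isFrobSemisimplificationOf r
  refine ⟨r', hr', hr'.1.trans hN, fun u hu => (hr'.2.1 u hu).trans (hρ u hu), fun w => ?_⟩
  obtain ⟨-, m, hm, hc, hsum⟩ := hr'.2.2 w
  rw [hsum]
  exact (LinearMap.charpoly_add_eq_of_isNilpotent_of_commute hm hc).symm

/-- **The formal matching.**  Let `rℂ` be a Weil–Deligne representation on `ℂⁿ` with `N = 0`,
trivial on inertia, whose geometric Frobenii (`deg Φ = -1`) have characteristic polynomial `P`, and
let `c` be a Frobenius-semisimple class every representative of which has `N = 0`, is trivial on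
inertia and has the same geometric-Frobenius characteristic polynomial `P`.  Then `rℂ^{F-ss}` lies
in `c` (`HasFrobSemisimpleClass`): `rℂ^{F-ss}` (`exists_frobSemisimplification_unramified`) and a
representative of `c` satisfy the hypotheses of the uniqueness stub H1
(`stub_wdUnramified_isEquivalent_of_charpoly_eq`). [cite: TateCorvallis1979, (4.1.3)–(4.1.6)]
[cite: DeligneAntwerpII1973, §8.6] -/
theorem hasFrobSemisimpleClass_of_unramified_charpoly (r : WeilDeligneRep F ℂ (Fin n → ℂ))
    (hN : r.N = 0) (hρ : WeilGroup.IsUnramifiedRep r.ρ) (P : ℂ[X])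
    (hP : ∀ Φ : WeilGroup F, WeilGroup.deg Φ = -1 → (r.ρ Φ).charpoly = P)
    (c : Quotient (frobSemisimpleWDSetoid F n))
    (hc : ∀ (A : WeilDeligneRep F ℂ (Fin n → ℂ)) (hA : A.IsFrobSemisimple),
      c = Quotient.mk (frobSemisimpleWDSetoid F n) ⟨A, hA⟩ →
        A.N = 0 ∧ WeilGroup.IsUnramifiedRep A.ρ ∧
          ∀ Φ : WeilGroup F, WeilGroup.deg Φ = -1 → (A.ρ Φ).charpoly = P) :
    r.HasFrobSemisimpleClass c := by
  obtain ⟨r', hr', hN', hρ', hchar⟩ := exists_frobSemisimplification_unramified r hN hρ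
  obtain ⟨Φ, hΦ⟩ := WeilGroup.deg_surjective IsFrobPow.mul_holds IsFrobPow.unique_holds
    (exists_isFrobPow_holds F) (-1 : ℤ)
  obtain ⟨⟨A, hA⟩, rfl⟩ := Quotient.exists_rep c
  obtain ⟨hAN, hAρ, hAchar⟩ := hc A hA rfl
  have he : r'.IsEquivalent A :=
    stub_wdUnramified_isEquivalent_of_charpoly_eq F n r' A Φ hΦ hN' hAN hρ' hAρ hr'.isFrobSemisimple hA
      (by rw [hchar Φ, hP Φ hΦ, hAchar Φ hΦ])
  exact ⟨r', hr', Quotient.sound he⟩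

end WD

/-! ### `GL₂`: local–global compatibility at the Satake-compatible places, for every `Rec` -/

section RankTwo

variable {K : Type} [Field K] [NumberField K] {ℓ : ℕ} [Fact ℓ.Prime]

/-- **`GL₂`, the matching data at a Satake-compatible place.**  Let `π` be cuspidal on `GL₂(𝔸_K)`
and `ρ : Γ_K → GL₂(ℚ̄_ℓ)` Satake–Frobenius compatible with `π` at `v` (Satake parameter `α`).  Then
`ρ` is unramified at `v` and, for EVERY reciprocity datum `Rec`, there are a local component `π_v`
of `π` at `v` (`exists_hasLocalComponentAt_of_isAdmissible`, Harish-Chandra admissibility) and a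
transport `rℂ` of `(ρ|_{W_{K_v}}, 0)` along `ι` with `rℂ^{F-ss} ∈ rec_v(π_v)`: the Galois side
(stub H2) gives `N = 0`, trivial inertia and geometric-Frobenius characteristic polynomial
`∏_{a ∈ α} (X - a)` for `rℂ`, the automorphic side (stub H3: clause (iii-L) of `Rec.llc v` and the
spherical zeta integral) gives the same for every Frobenius-semisimple representative of
`rec_v(π_v)`, and `hasFrobSemisimpleClass_of_unramified_charpoly` matches them.
[cite: BuzzardGeeLMS2014, Conj. 3.2.1–3.2.2] [cite: HarrisTaylorAMS2001, Thm. A (ii), (v)]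
[cite: TateCorvallis1979, (4.1.3)–(4.2.1)] -/
theorem rankTwo_matching_of_satakeFrobCompatibleAt {hcpt : isCompact_glFiniteIntegralLevel 2 K}
    (Rec : ReciprocityData K) (ι : PadicAlgCl ℓ ≃+* ℂ) (π : CuspidalAutomorphicRepData 2 K hcpt)
    (ρ : FramedGaloisRep K (PadicAlgCl ℓ) 2) {v : HeightOneSpectrum (𝓞 K)}
    (hsat : SatakeFrobCompatibleAt ι π.1 ρ v) :
    ∃ (hρ : ρ.IsUnramifiedAt v) (πv : SmoothIrrep (GL (Fin 2) (v.adicCompletion K)))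
      (rℂ : WeilDeligneRep (v.adicCompletion K) ℂ (Fin 2 → ℂ)),
      π.1.HasLocalComponentAt v πv.ρ ∧
        (WeilDeligneRep.ofRep ((ρ.toLocal v).weilRestrict (v.adicCompletion K))
          (isLocallyUnramified_toLocal_of_isUnramifiedAt ρ v hρ).isUnramifiedRep_weilRestrict.isContinuousRep).IsTransportAlong
            (ι : PadicAlgCl ℓ →+* ℂ) rℂ ∧
        rℂ.HasFrobSemisimpleClass ((Rec.llc v).recGL 2 (IrrClass.mk πv)) := by
  obtain ⟨α, hα, hρ, hcp⟩ := hsat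
  obtain ⟨πv, hloc⟩ := AutomorphicRepData.exists_hasLocalComponentAt_of_isAdmissible
    (automorphicRep_isAdmissible_holds hcpt) π.1 v
  obtain ⟨rℂ, htr⟩ := exists_isTransportAlong (ι : PadicAlgCl ℓ →+* ℂ)
    (WeilDeligneRep.ofRep ((ρ.toLocal v).weilRestrict (v.adicCompletion K))
      (isLocallyUnramified_toLocal_of_isUnramifiedAt ρ v hρ).isUnramifiedRep_weilRestrict.isContinuousRep)
  obtain ⟨hN, hunr, hchar⟩ := stub_transport_frobCharpoly K ℓ 2 ι ρ v hρ α hcp rℂ htr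
  exact ⟨hρ, πv, rℂ, hloc, htr, hasFrobSemisimpleClass_of_unramified_charpoly rℂ hN hunr _ hchar _
    fun A hA hAc => stub_recGL_two_unramified K hcpt π v α hα (Rec.llc v) πv hloc A hA hAc⟩

/-- **`GL₂`: local–global compatibility at every Satake-compatible place, for EVERY reciprocity
datum** (under `FontaineDatumExists` at `v ∣ ℓ`, unconditionally at `v ∤ ℓ`).  For `π` cuspidal on
`GL₂(𝔸_K)`, `ρ : Γ_K → GL₂(ℚ̄_ℓ)` and a finite place `v` with `SatakeFrobCompatibleAt ι π ρ v`:
`LocalGlobalCompatibleAt Rec ι π ρ v`.  Assembles `rankTwo_matching_of_satakeFrobCompatibleAt` with the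
unramified-sector reductions of the summit's clause — c4 `localGlobalCompatibleAt_away_of_isUnramifiedAt`
(+ the inertia character `WeilGroup.exists_inertiaCharacter_ne_one_top`) at `v ∤ ℓ`, c3
`localGlobalCompatibleAt_above_of_isUnramifiedAt` (clause (F8) of the pinned Fontaine datum) at `v ∣ ℓ`.
So in rank two both local–global stubs of the line hold, for every `Rec`, at all places where the
pair is Satake–Frobenius compatible — in particular at all but finitely many places of any
a.e.-compatible pair. [cite: BuzzardGeeLMS2014, Conj. 3.2.1–3.2.2] [cite: TateCorvallis1979, (4.2.1)]
[cite: FontaineAsterisque223VIII, §2.3.7] -/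
theorem rankTwo_localGlobalCompatibleAt_of_satakeFrobCompatibleAt (hF : FontaineDatumExists)
    {hcpt : isCompact_glFiniteIntegralLevel 2 K} (Rec : ReciprocityData K) (ι : PadicAlgCl ℓ ≃+* ℂ)
    (π : CuspidalAutomorphicRepData 2 K hcpt) (ρ : FramedGaloisRep K (PadicAlgCl ℓ) 2)
    {v : HeightOneSpectrum (𝓞 K)} (hsat : SatakeFrobCompatibleAt ι π.1 ρ v) :
    LocalGlobalCompatibleAt Rec ι π.1 ρ v := by
  obtain ⟨hρ, πv, rℂ, hloc, htr, hcls⟩ := rankTwo_matching_of_satakeFrobCompatibleAt Rec ι π ρ hsat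
  by_cases hv : ((ℓ : ℕ) : 𝓞 K) ∈ v.asIdeal
  · exact localGlobalCompatibleAt_above_of_isUnramifiedAt hF Rec ι π.1 ρ hv hρ πv hloc rℂ htr hcls
  · exact localGlobalCompatibleAt_away_of_isUnramifiedAt Rec ι π.1 ρ hv hρ
      (WeilGroup.exists_inertiaCharacter_ne_one_top (F := v.adicCompletion K) (PadicAlgCl ℓ))
      πv hloc rℂ htr hcls

/-- **`GL₂`: `Corresponds` reduces to the bad places, for every `Rec`.**  If `ρ` is Satake–Frobenius
compatible with the cuspidal `π` on `GL₂(𝔸_K)` at all but finitely many places, then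
`Corresponds Rec ι π ρ` holds as soon as local–global compatibility is known at the places where they
are NOT Satake–Frobenius compatible — the exact residue, in rank two, of the line's two local–global
stubs (the places where `π_v` or `ρ` ramifies: blockers B1/B2 of the crux notes).
[cite: BuzzardGeeLMS2014, Conj. 3.2.1–3.2.2] [cite: HarrisTaylorAMS2001, Thm. A] -/
theorem rankTwo_corresponds_of_badPlaces (hF : FontaineDatumExists)
    {hcpt : isCompact_glFiniteIntegralLevel 2 K} (Rec : ReciprocityData K) (ι : PadicAlgCl ℓ ≃+* ℂ)
    (π : CuspidalAutomorphicRepData 2 K hcpt) (ρ : FramedGaloisRep K (PadicAlgCl ℓ) 2)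
    (hae : ∀ᶠ v : HeightOneSpectrum (𝓞 K) in cofinite, SatakeFrobCompatibleAt ι π.1 ρ v)
    (hbad : ∀ v : HeightOneSpectrum (𝓞 K), ¬ SatakeFrobCompatibleAt ι π.1 ρ v →
      LocalGlobalCompatibleAt Rec ι π.1 ρ v) :
    Corresponds Rec ι π.1 ρ := by
  refine ⟨hae, fun v => ?_⟩
  by_cases h : SatakeFrobCompatibleAt ι π.1 ρ v
  · exact rankTwo_localGlobalCompatibleAt_of_satakeFrobCompatibleAt hF Rec ι π ρ h
  · exact hbad v h

/-- **`GL₂`: the unramified sector of both local–global stubs of the line, for EVERY `Rec`** — the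
shape of `stub_pairCompatibilityAway` / `stub_pairCompatibilityAbove` restricted to the Satake-compatible
places, with `∃ Rec` strengthened to `∀ Rec` and no irreducibility / geometricity / algebraicity
hypothesis: for every number field `K`, every `Rec`, every cuspidal `π` on `GL₂(𝔸_K)`, every
`ρ : Γ_K → GL₂(ℚ̄_ℓ)` and every finite `v`, `SatakeFrobCompatibleAt ι π ρ v → LocalGlobalCompatibleAt Rec ι π ρ v`.
[cite: BuzzardGeeLMS2014, Conj. 3.2.1–3.2.2] [cite: TateCorvallis1979, (4.2.1)] -/
theorem rankTwo_pairCompatibility_satakeSector (hF : FontaineDatumExists) :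
    ∀ (K : Type) [Field K] [NumberField K] (Rec : ReciprocityData K)
      (hcpt : isCompact_glFiniteIntegralLevel 2 K) (π : CuspidalAutomorphicRepData 2 K hcpt)
      (ℓ : ℕ) [Fact ℓ.Prime] (ι : PadicAlgCl ℓ ≃+* ℂ) (ρ : FramedGaloisRep K (PadicAlgCl ℓ) 2)
      (v : HeightOneSpectrum (𝓞 K)), SatakeFrobCompatibleAt ι π.1 ρ v →
        LocalGlobalCompatibleAt Rec ι π.1 ρ v :=
  fun _ _ _ Rec _ π _ _ ι ρ _ hsat =>
    rankTwo_localGlobalCompatibleAt_of_satakeFrobCompatibleAt hF Rec ι π ρ hsat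

/-- **Registered stub `stub_rankTwo_localGlobalCompatibleAt_of_satakeFrobCompatibleAt` of line `Sketch`
(crux stmt-Langlands-14328), closed form of `rankTwo_localGlobalCompatibleAt_of_satakeFrobCompatibleAt`**:
`GL₂`, every `Rec` — Satake–Frobenius compatibility at `v` implies local–global compatibility at `v`
(under `FontaineDatumExists`, used at `v ∣ ℓ` only). [cite: BuzzardGeeLMS2014, Conj. 3.2.1–3.2.2]
[cite: TateCorvallis1979, (4.2.1)] -/
theorem stub_rankTwo_localGlobalCompatibleAt_of_satakeFrobCompatibleAt :
    FontaineDatumExists → ∀ (K : Type) [Field K] [NumberField K] (ℓ : ℕ) [Fact ℓ.Prime]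
      (hcpt : isCompact_glFiniteIntegralLevel 2 K) (Rec : ReciprocityData K) (ι : PadicAlgCl ℓ ≃+* ℂ)
      (π : CuspidalAutomorphicRepData 2 K hcpt) (ρ : FramedGaloisRep K (PadicAlgCl ℓ) 2)
      (v : HeightOneSpectrum (𝓞 K)), SatakeFrobCompatibleAt ι π.1 ρ v → LocalGlobalCompatibleAt Rec ι π.1 ρ v :=
  fun hF _ _ _ _ _ _ Rec ι π ρ _ hsat =>
    rankTwo_localGlobalCompatibleAt_of_satakeFrobCompatibleAt hF Rec ι π ρ hsat

end RankTwo

/-! ### `GL_n`: the same modulo the Jacquet–Shalika unramified computation -/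

section RankN

variable {K : Type} [Field K] [NumberField K] {ℓ : ℕ} [Fact ℓ.Prime] {n : ℕ}

/-- **`GL_n`, `2 ≤ n`: local–global compatibility at every Satake-compatible place, for EVERY
reciprocity datum, modulo the Jacquet–Shalika unramified computation.**  Hypothesis `hJS`: the named
fact `hasRSLFactor_of_isSatakeParameter_haar` of `RankinSelbergLocal` at `(n, 1)` for the irreducible
smooth representations of `GL_n(K_v)` against the trivial representation of `GL₁(K_v)` (the JPSS
`L`-polynomial of a spherical generic pair is `∏ (1 - a b T)`; Jacquet–Shalika 1981 §2; a theorem of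
the tree for `n = 2`, cf. `rankTwo_localGlobalCompatibleAt_of_satakeFrobCompatibleAt`).  Then for `π`
cuspidal on `GL_n(𝔸_K)`, `ρ : Γ_K → GL_n(ℚ̄_ℓ)` and `v` with `SatakeFrobCompatibleAt ι π ρ v`:
`LocalGlobalCompatibleAt Rec ι π ρ v` (under `FontaineDatumExists` at `v ∣ ℓ`).  Stubs H1, H2, H4 +
§1e. [cite: JacquetShalika1981, §2] [cite: BuzzardGeeLMS2014, Conj. 3.2.1–3.2.2]
[cite: HarrisTaylorAMS2001, Thm. A (ii), (v)] [cite: TateCorvallis1979, (4.1.3)–(4.2.1)] -/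
theorem localGlobalCompatibleAt_of_satakeFrobCompatibleAt_of_unramifiedComputation
    (hF : FontaineDatumExists) (hn : 1 < n) {hcpt : isCompact_glFiniteIntegralLevel n K}
    (Rec : ReciprocityData K) (ι : PadicAlgCl ℓ ≃+* ℂ) (π : CuspidalAutomorphicRepData n K hcpt)
    (ρ : FramedGaloisRep K (PadicAlgCl ℓ) n) {v : HeightOneSpectrum (𝓞 K)}
    (hJS : ∀ (πv : SmoothIrrep (GL (Fin n) (v.adicCompletion K)))
      (ψ : AddChar (v.adicCompletion K) Circle)
      [MeasurableSpace (GL (Fin 1) (v.adicCompletion K) ⧸ upperUnitriangular (Fin 1) (v.adicCompletion K))]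
      [BorelSpace (GL (Fin 1) (v.adicCompletion K) ⧸ upperUnitriangular (Fin 1) (v.adicCompletion K))]
      (ν : MeasureTheory.Measure
        (GL (Fin 1) (v.adicCompletion K) ⧸ upperUnitriangular (Fin 1) (v.adicCompletion K)))
      [MeasureTheory.SMulInvariantMeasure (GL (Fin 1) (v.adicCompletion K))
        (GL (Fin 1) (v.adicCompletion K) ⧸ upperUnitriangular (Fin 1) (v.adicCompletion K)) ν]
      [MeasureTheory.IsFiniteMeasureOnCompacts ν] [ν.IsOpenPosMeasure],
      hasRSLFactor_of_isSatakeParameter_haar hn πv.ρ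
        (Representation.trivial ℂ (GL (Fin 1) (v.adicCompletion K)) ℂ) ψ ν)
    (hsat : SatakeFrobCompatibleAt ι π.1 ρ v) :
    LocalGlobalCompatibleAt Rec ι π.1 ρ v := by
  obtain ⟨α, hα, hρ, hcp⟩ := hsat
  obtain ⟨πv, hloc⟩ := AutomorphicRepData.exists_hasLocalComponentAt_of_isAdmissible
    (automorphicRep_isAdmissible_holds hcpt) π.1 v
  obtain ⟨rℂ, htr⟩ := exists_isTransportAlong (ι : PadicAlgCl ℓ →+* ℂ)
    (WeilDeligneRep.ofRep ((ρ.toLocal v).weilRestrict (v.adicCompletion K))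
      (isLocallyUnramified_toLocal_of_isUnramifiedAt ρ v hρ).isUnramifiedRep_weilRestrict.isContinuousRep)
  obtain ⟨hN, hunr, hchar⟩ := stub_transport_frobCharpoly K ℓ n ι ρ v hρ α hcp rℂ htr
  have hcls : rℂ.HasFrobSemisimpleClass ((Rec.llc v).recGL n (IrrClass.mk πv)) :=
    hasFrobSemisimpleClass_of_unramified_charpoly rℂ hN hunr _ hchar _ fun A hA hAc =>
      stub_recGL_unramified_of_unramifiedComputation K n hn hcpt π v α hα (Rec.llc v) πv hloc
        (by intro ψ _ _ ν _ _ _; exact hJS πv ψ ν) A hA hAc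
  by_cases hv : ((ℓ : ℕ) : 𝓞 K) ∈ v.asIdeal
  · exact localGlobalCompatibleAt_above_of_isUnramifiedAt hF Rec ι π.1 ρ hv hρ πv hloc rℂ htr hcls
  · exact localGlobalCompatibleAt_away_of_isUnramifiedAt Rec ι π.1 ρ hv hρ
      (WeilGroup.exists_inertiaCharacter_ne_one_top (F := v.adicCompletion K) (PadicAlgCl ℓ))
      πv hloc rℂ htr hcls

/-- **`GL_n`: `Corresponds` reduces to the bad places, for every `Rec`, modulo the Jacquet–Shalika
unramified computation at the places of `K`** (hypothesis `hJS` at every finite place).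
[cite: JacquetShalika1981, §2] [cite: BuzzardGeeLMS2014, Conj. 3.2.1–3.2.2] -/
theorem corresponds_of_badPlaces_of_unramifiedComputation (hF : FontaineDatumExists) (hn : 1 < n)
    {hcpt : isCompact_glFiniteIntegralLevel n K} (Rec : ReciprocityData K) (ι : PadicAlgCl ℓ ≃+* ℂ)
    (π : CuspidalAutomorphicRepData n K hcpt) (ρ : FramedGaloisRep K (PadicAlgCl ℓ) n)
    (hJS : ∀ (v : HeightOneSpectrum (𝓞 K)) (πv : SmoothIrrep (GL (Fin n) (v.adicCompletion K)))
      (ψ : AddChar (v.adicCompletion K) Circle)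
      [MeasurableSpace (GL (Fin 1) (v.adicCompletion K) ⧸ upperUnitriangular (Fin 1) (v.adicCompletion K))]
      [BorelSpace (GL (Fin 1) (v.adicCompletion K) ⧸ upperUnitriangular (Fin 1) (v.adicCompletion K))]
      (ν : MeasureTheory.Measure
        (GL (Fin 1) (v.adicCompletion K) ⧸ upperUnitriangular (Fin 1) (v.adicCompletion K)))
      [MeasureTheory.SMulInvariantMeasure (GL (Fin 1) (v.adicCompletion K))
        (GL (Fin 1) (v.adicCompletion K) ⧸ upperUnitriangular (Fin 1) (v.adicCompletion K)) ν]
      [MeasureTheory.IsFiniteMeasureOnCompacts ν] [ν.IsOpenPosMeasure],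
      hasRSLFactor_of_isSatakeParameter_haar hn πv.ρ
        (Representation.trivial ℂ (GL (Fin 1) (v.adicCompletion K)) ℂ) ψ ν)
    (hae : ∀ᶠ v : HeightOneSpectrum (𝓞 K) in cofinite, SatakeFrobCompatibleAt ι π.1 ρ v)
    (hbad : ∀ v : HeightOneSpectrum (𝓞 K), ¬ SatakeFrobCompatibleAt ι π.1 ρ v →
      LocalGlobalCompatibleAt Rec ι π.1 ρ v) :
    Corresponds Rec ι π.1 ρ := by
  refine ⟨hae, fun v => ?_⟩
  by_cases h : SatakeFrobCompatibleAt ι π.1 ρ v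
  · exact localGlobalCompatibleAt_of_satakeFrobCompatibleAt_of_unramifiedComputation hF hn Rec ι π ρ
      (hJS v) h
  · exact hbad v h

end RankN

end Summit.Langlands.Langlands.Theorems.ReciprocityUpToIrreducibility

end
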